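import Summits.FinalStateConjecture.FinalStateConjecture.Theses.PhaseMixingCapture
import Literature.Geometry.Lorentzian.BlackHoles

/-!
# Disproof of `KappaExplicitWaveDecay` — standing adversary file (cdisprove seat)

Crux item `stmt-FinalStateConjecture-10654`, decl
`Summit.FinalStateConjecture.FinalStateConjecture.Theses.PhaseMixingCapture.KappaExplicitWaveDecay`
(route `PhaseMixingCapture`, rank 3): κ-explicit Dafermos–Rodnianski–Shlapentokh-Rothman on the whole
sub-extremal range — `∀ M > 0 ∃ p j`, (a) `sliceEnergy ψ τ ≤ C(M) (1-(a/M)²)^(-p) E_j[ψ](0)` for all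
`|a| < M`, admissible `ψ`, `τ ≥ 0`; (b) `∫₀^∞ E_loc(τ,R) dτ ≤ C(M,R) (1-(a/M)²)^(-p) E_j[ψ](0)`.

## Findings (cycle 1, 2026-08-16) — NO KILL; numerical probe j013848 SUPPORTS the crux (item 4 below).
## Kernel-checked content of this file (0 sorry):

* §1 `kappaExplicitWaveDecay_iff` — READBACK: the crux is, by `Iff.rfl`, the bundled statement
  `∀ [Facts] [SliceFacts] M > 0, ∃ p j, ClauseA M p j ∧ ClauseB M p j` in terms of
  `IsAdmissible`, `HasCompactData`, `kappaFactor`, `initEnergy` (use these names).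
* §2 BOUNDARY of the κ-weight: `kappaFactor_extremal` (`= 0` at `|a| = M` for `p ≠ 0`: junk
  `Real.rpow 0`), `one_le_kappaFactor`, `kappaFactor_lt_top`, `kappaFactor_mono` (monotone in `p` on
  `|a| < M`).
* §3 NON-VACUITY and WLOG: `isAdmissible_zero`, `sliceEnergy_zero_wave`; `clauseAWith_mono`,
  `clauseBWith_mono`, `clauses_mono` — the estimate is monotone in `(C, p, j)`, so provers may take
  `p, j` as large as convenient (`j ≥ 1` forced in (a) by data `(0, ∂_t ψ)`, `j ≥ 2` in (b) by the
  trapping derivative loss — on paper).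
* §4 LOAD-BEARING `□_g ψ = 0`, BOTH conjuncts, sorry-free (axioms `propext/choice/Quot.sound`):
  `kappaExplicitWaveDecay_false_without_waveEq` (conjunct (a)) and `clauseB_false_without_waveEq`
  (conjunct (b)): delete the wave equation and each clause is FALSE on Schwarzschild `M = 1, a = 0`
  for every `(p, j, C)` (and `R = 3`): the smooth `ψ(t*,y) = expNegInvGlue (t* - 1/3)` has data
  vanishing identically near `{t* = 0}` (`E_j[ψ](0) = 0`, `K = ∅`) but `sliceEnergy ψ τ₀ > 0`,
  `∫₀^∞ E_loc(τ,3) dτ > 0` (`τ₀ ∈ (1/3, 4/3)` by the mean value theorem, an interval around it by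
  continuity of `ψ'`). Moral: the proof must use `□ψ = 0` to transport size/vanishing of data OFF the
  initial leaf (domain of dependence / energy identity) — nothing else constrains `ψ` at `t* > 0`.
  `withoutWaveEq_implies` / `withoutWaveEq_conjB_of` certify that the refuted statements are the crux
  minus exactly that clause. LANDED (accepted): p73071 = `Theorems/KappaExplicitWaveDecay/Negative/
  FalseWithoutWaveEq.lean` (conjunct (a), reusable `Witness.prof/Psi/psi`) and p74381 =
  `…/Negative/FalseWithoutWaveEqILED.lean` (conjunct (b)); import them instead of re-proving.
* §5 the `IsSubextremal` GUARD: `clauseA_false_at_extremal_of_wave` — without the guard, (a) with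
  `p ≠ 0` is false as soon as ONE admissible wave with positive energy exists on extremal Kerr
  (paper-trivial, not constructible in the tree); `ExtremalWaveExists` names that hypothesis.
* §6 SHAPE OF A KILL: `not_kappaExplicitWaveDecay_iff` — a refutation must PRODUCE instances of
  `Kerr.Facts`/`Kerr.SliceFacts` and, for every `(p, j, C)`, an explicit admissible wave beating the
  bound; `axisymmetric_of_kappa` / `not_kappa_of_not_axisymmetric` — the crux implies its support item
  (rank 9), whose sector `m = 0` is the most ROBUST one (attack `|m| ≥ 2`, `m → ∞` instead).
* §7 SMALL-MODEL ALGEBRA of the near zone at threshold (`nearZoneNumerator`, discriminant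
  `Λ(Λ - 4σm + 4σ²)`, superradiant side always has a barrier with an OPEN horizon-side well, the
  barrier-free window, the degenerate well at `σ = 0`) — the phase portrait behind item 3 below.

## Why the crux resists (paper analysis; page-cited)

1. HONEST FORMALISATION. `dalembertian` = trace of the Koszul/Hessian `choose`-definitions
   (LeviCivita.lean §Hessian), uniquely pinned for `C²` functions, junk only for non-smooth `ψ`
   (excluded by `ContMDiff ⊤`); `sliceEnergy` = coordinate energy through the horizon-penetrating
   Kerr–Schild leaf `{t* = τ} ∩ {r > r₊}` down to `r → r₊⁺`; admissible data live in a compact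
   subset of the OPEN leaf `{t* = 0, r > r₊}` (vanish near `𝓗⁺` and infinity);
   `{t* ≥ 0, r > r₊} ⊆ D⁺(leaf)` (past-directed causal curves reach `r = r₊` only as `t* → -∞`), so
   for `τ ≥ 0` the LHS is determined by the data. No junk route; no nonzero admissible wave is
   constructible (no Cauchy theory for `□_g` in the tree; `t_BL` is harmonic but not compactly
   supported; stationary solutions die by unique continuation, the reduced operator being elliptic
   on the spacelike leaves).
2. WHAT HAPPENS AT `κ = 0` FOR OUR DATA CLASS (Gajic, arXiv:2302.06636): Thm 1.1 (p.3) / Thm 4.2,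
   Cor 4.3 (pp.22–23): for smooth COMPACTLY SUPPORTED data on a fixed mode `|m| ≥ 2` with
   `h_m ≠ 0` (generic), first transversal derivatives grow `≳ τ^{1/2}` along `𝓗⁺` and the
   non-degenerate energy is NON-DECAYING (bounded for fixed `m`, Thm 1.2), concentrating at the
   horizon (Rem. 1.2, p.4); Rem. 1.3(3) (p.4): unlike axisymmetry, data supported away from `𝓗⁺`
   do NOT weaken this. Consequences for the crux: at `κ = 0` conjunct (b) fails for every `j`
   (`E_loc` non-decaying on horizon-penetrating leaves), conjunct (a) holds mode by mode. Hence the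
   κ-dependence of (b) is NECESSARY and, heuristically (transient duration `≍ κ⁻¹`, GZZ below),
   `p ≥ 1/2` in (b); `p = 0` ("κ-uniform DRSR") is expected FALSE but is not refuted in print
   (needs quantitative near-extremal/extremal closeness up to `τ ≍ κ⁻¹`).
3. POLYNOMIAL TRANSIENTS, FIXED MODE (Gralla–Zimmerman–Zimmerman, arXiv:1608.04739 = PRD 94
   084017): near-horizon-mode response `G_NHM ∝ σ^{1-α₊}/𝒞`, growth until `V ≍ 1/σ`, maximal
   amplitude `σ^{1/2-s}`, each `x`-derivative one power of `V` faster (p.6); `E_obs ≍ σ^{-1}`,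
   `∂_xΦ ≍ σ^{-1/2}` (p.8); `σ = (r₊-r₋)/r₊ ≍ κ`; ZDM frequencies `2ω̄_n = m - δ - i(n+½) + η`
   (p.5): damping `≍ κ` UNIFORMLY in `(ℓ, m)`; the excitation factor `1/|𝒞|` decays like
   `e^{-πm/2+πδ/2}` in `m`. All exponents of `κ` are `(ℓ,m)`-INDEPENDENT for principal modes.
4. THE ONLY UNCHARTED REGIME (Gajic §1.4, p.10, verbatim): extending uniformly in `m` "would require
   revisiting the analysis in the frequency regime `|ω - mω₊| ≪ |m|` ... In view of the existence
   of trapped null geodesics arbitrarily close to `𝓗⁺`, one would expect ... an additional loss of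
   azimuthal derivatives. As this frequency regime is both superradiant and is affected by trapping,
   it could also lead to more severe deviations from the bounded-`m` setting and perhaps even to
   stronger instabilities that are not visible for bounded `m`." A kill of the crux (finite `p` for
   EVERY `j`) needs the κ-exponent to drift unboundedly with `m` (scenario `A_m(κ) ≍ κ^{-c m}`) or
   an `exp(c/κ)`; §7 shows the near-zone phase portrait has no closed cavity (horizon end open,
   barrier top = in-throat photon orbit with Lyapunov exponent `≍ κ`), so the semiclassical
   expectation is `κ^{-1} log m` — polynomial. IN PRINT, on bounded boxes: Teixeira da Costa,
   arXiv:1910.02854 = CMP 378 (2020), Thm 5.1: `sup_𝒜 |𝔚|⁻¹ ≤ G(C_𝒜, M, |s|)` for every `|a| ≤ M`,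
   with `C_𝒜 = sup_{[-M,M]×𝒜}(|ω| + |ω|⁻¹ + |ω - am/2M²|⁻¹ δ_{|a|,M} + |m| + |λ|)` — the sup over `a`
   inside `C_𝒜` means the box must EXCLUDE a neighbourhood of the extremal threshold `ω = m/2M`;
   Prop. 6.3 / Remark 6.4 (§6.2): at `|a| = M`, `s = 0`, `|𝔚|⁻² ≲ |ω - mω₊|⁻¹` (rate of vanishing at
   the threshold). So the real-axis Wronskian is controlled uniformly in `a` away from `m/2M`, may
   vanish like `|ω - m/2M|^{1/2}` at it, and the growth of `G` in the box size (`m → ∞`) is explicit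
   but not tracked — the probe below measures both.
   NUMERICAL PROBE (kit job j013848, evidence on the item; script job1/main.py of the cdisprove folder;
   s = 0 radial Teukolsky ODE, M = 1, Frobenius at 𝓗⁺ + RK4 + asymptotic series, flux-conservation
   residual ≤ 4e-8, Frobenius tail 0): κ = 0.152 … 0.0022 (a = 0.9 … 0.99999), (ℓ,m) = (1,1) …
   (16,16), 401 real frequencies per case in |ω - mΩ_H| ≤ 40κ (this window contains the in-throat
   barrier top `2σ₋(m)` for every m ≤ 16; the minimiser sits ON it: `ŝ* = 1.4, 1.8, 2.0, 2.6, 3.2`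
   for m = 2, 6, 8, 12, 16). Fitted exponents d log Q / d log κ at the smallest κ, principal modes
   ℓ = m = 2, 3, 4, 6, 8, 12, 16:
     min_ω |W| (unit-normalised real-axis Wronskian):  +0.502 +0.502 +0.503 +0.503 +0.505 +0.505 +0.504
     horizon transversal derivative / unit incidence:   -1.507 -1.511 -1.512 -1.514 -1.517 -1.517 -1.516
     same at x = r₊-r₋ off the horizon:                  -1.50 (all m);  at fixed x = 0.1: -0.11 → 0
     superradiant gain Z_max: saturates (3.50e-3 for (1,1) = the known 0.37 %; 2.0e-3 (2,2); 4.6e-8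
     (16,16)).
   I.e. `1/|W| ≍ κ^{-1/2}` and `|∂_r ψ̃|_{𝓗⁺} ≍ κ^{-3/2}` per unit incident amplitude (`≍ κ^{-1/2}` for a
   κ-band-limited packet, the CGZ/GZZ rate), growth confined to the layer `r - r₊ ≲ κ`, with
   exponents INDEPENDENT of m to three digits — exactly the zero-damped-mode picture (GZZ:
   `∂Z_in/∂ω̄ ∝ σ^{α₊}`, `Re α₊ = 1/2`, poles at distance `≍ σ` below the axis; consistent with
   Teixeira da Costa's Thm 5.1, whose `C_𝒜` EXCLUDES a neighbourhood of the extremal threshold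
   `ω = m/2M` — the sub-extremal minimisers converge to it). In m at fixed κ the amplification grows
   only polynomially (`D1 ≈ m^{1.3}`; threshold transmission DEcays like `e^{-0.3 m}`). Supplementary
   modes (m = 1, ℓ > m) are tamer (slopes → 0). VERDICT OF THE PROBE: no kill signal; quantitative
   support for the crux with `p` of order one and finite `j` (caveats: m ≤ 16, linear radial-ODE
   level, real frequencies only — the joint limit `m ≍ κ^{-α}` and time-domain summation untested).
5. Negatives index for FinalStateConjecture: empty. Barrier catalogue: `AretakisInstability(Narrow)`
   bites only κ-UNIFORM (`p = 0`) estimates — consistent with item 2; `SbierskiKerrTrappingLED`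
   forces `j ≥ 2` in (b), met by `∃ j`.

## Open targets for later cycles
* `p = 0` refutation on paper (item 2) → would become a tightness theorem modulo a near-extremal
  Cauchy-stability fact; the `0 ≤ τ` guard (backward freedom near `𝓗⁺`: false without it on paper,
  needs a backward/sideways wave); lead's stuck stubs once a line is picked (payload.targets empty).
-/

noncomputable section

namespace Summit.FinalStateConjecture.FinalStateConjecture.Cruxes.KappaExplicitWaveDecay.Disproof

open Literature.Geometry.Lorentzian
open Summit.FinalStateConjecture.FinalStateConjecture.Theses.PhaseMixingCapture
open scoped Manifold ENNReal Topology ContDiff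
open Filter Set MeasureTheory

/-! ## §1 Readback: bundled form of the crux -/

/-- The κ-weight `(1 - (a/M)²)^(-p)` of the crux, as an extended nonnegative real. -/
def kappaFactor (M a p : ℝ) : ℝ≥0∞ := ENNReal.ofReal ((1 - (a / M) ^ 2) ^ (-p))

/-- The order-`j` unweighted coordinate energy of the zero-extended `ψ` through `{t* = 0} ∩ {r > r₊}`
(the RHS norm of the crux; `= sliceSobolevEnergy … 0 j 0 univ` of Sweep2). -/
def initEnergy (M a : ℝ) (ψ : Kerr.exterior M a → ℝ) (j : ℕ) : ℝ≥0∞ :=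
  ∫⁻ y : E3, {y | E4.ofTimeSpace 0 y ∈ Kerr.exterior M a}.indicator (fun y ↦ ENNReal.ofReal
    (∑ m ∈ Finset.range (j + 1), ‖iteratedFDeriv ℝ m (Function.extend Subtype.val ψ
      (0 : E4 → ℝ)) (E4.ofTimeSpace 0 y)‖ ^ 2)) y

/-- The data clause of admissibility: `ψ` and `dψ` vanish on `{t* = 0}` off a compact set of the
open exterior. -/
def HasCompactData (M a : ℝ) (ψ : Kerr.exterior M a → ℝ) : Prop :=
  ∃ K : Set (Kerr.exterior M a), IsCompact K ∧ ∀ x : Kerr.exterior M a, (x : E4) 0 = 0 → x ∉ K →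
    ψ x = 0 ∧ mfderiv 𝓘(ℝ, E4) 𝓘(ℝ, ℝ) ψ x = 0

/-- Admissible wave (inlined `IsAdmissibleKerrWave`): smooth, `□_g ψ = 0` on `{r > r₊}`, compact
data. -/
def IsAdmissible [Kerr.Facts] [Kerr.SliceFacts] (M a : ℝ) (ψ : Kerr.exterior M a → ℝ) : Prop :=
  ContMDiff 𝓘(ℝ, E4) 𝓘(ℝ, ℝ) ∞ ψ ∧
    (∀ x, (Kerr.smoothMetric M a (Kerr.rPlus M a)).toPseudoRiemannianMetric.dalembertian ψ x = 0) ∧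
      HasCompactData M a ψ

/-- Clause (a): κ-explicit uniform boundedness with constant `C`. -/
def ClauseAWith [Kerr.Facts] [Kerr.SliceFacts] (M p : ℝ) (j : ℕ) (C : ℝ≥0∞) : Prop :=
  ∀ a : ℝ, Kerr.IsSubextremal M a → ∀ ψ : Kerr.exterior M a → ℝ, IsAdmissible M a ψ →
    ∀ τ : ℝ, 0 ≤ τ → sliceEnergy (Kerr.exterior M a) ψ τ ≤ C * kappaFactor M a p * initEnergy M a ψ j

/-- Clause (a): κ-explicit uniform boundedness. -/
def ClauseA [Kerr.Facts] [Kerr.SliceFacts] (M p : ℝ) (j : ℕ) : Prop :=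
  ∃ C : ℝ≥0∞, C < ⊤ ∧ ClauseAWith M p j C

/-- Clause (b): κ-explicit integrated local energy decay at radius `R` with constant `C`. -/
def ClauseBWith [Kerr.Facts] [Kerr.SliceFacts] (M p : ℝ) (j : ℕ) (R : ℝ) (C : ℝ≥0∞) : Prop :=
  ∀ a : ℝ, Kerr.IsSubextremal M a → ∀ ψ : Kerr.exterior M a → ℝ, IsAdmissible M a ψ →
    ∫⁻ τ in Ioi (0 : ℝ), localSliceEnergy (Kerr.exterior M a) ψ τ R ≤
      C * kappaFactor M a p * initEnergy M a ψ j

/-- Clause (b): κ-explicit integrated local energy decay. -/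
def ClauseB [Kerr.Facts] [Kerr.SliceFacts] (M p : ℝ) (j : ℕ) : Prop :=
  ∀ R : ℝ, ∃ C : ℝ≥0∞, C < ⊤ ∧ ClauseBWith M p j R C

/-- READBACK. The crux is definitionally the bundled statement. -/
theorem kappaExplicitWaveDecay_iff :
    KappaExplicitWaveDecay ↔ ∀ [Kerr.Facts] [Kerr.SliceFacts], ∀ M : ℝ, 0 < M →
      ∃ (p : ℝ) (j : ℕ), ClauseA M p j ∧ ClauseB M p j :=
  Iff.rfl

/-! ## §2 Boundary behaviour of the κ-weight -/

/-- At `|a| = M` the weight collapses to the junk value `0` for every `p ≠ 0` (so an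
extremal-inclusive version with `p ≠ 0` would demand `sliceEnergy ≤ 0`). -/
theorem kappaFactor_extremal {M p : ℝ} (hM : M ≠ 0) (hp : p ≠ 0) :
    kappaFactor M M p = 0 ∧ kappaFactor M (-M) p = 0 := by
  have h1 : (1 - (M / M) ^ 2 : ℝ) = 0 := by rw [div_self hM]; ring
  have h2 : (1 - (-M / M) ^ 2 : ℝ) = 0 := by rw [neg_div, div_self hM]; ring
  simp [kappaFactor, h1, h2, Real.zero_rpow (neg_ne_zero.mpr hp)]

/-- On the sub-extremal range the base `1 - (a/M)²` lies in `(0, 1]`. -/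
theorem kappaBase_mem {M a : ℝ} (h : Kerr.IsSubextremal M a) :
    0 < 1 - (a / M) ^ 2 ∧ 1 - (a / M) ^ 2 ≤ 1 := by
  have hM : 0 < M := h.pos
  have ha : |a| < M := h
  have hq : (a / M) ^ 2 < 1 := by
    rw [div_pow, div_lt_one (by positivity)]
    exact sq_lt_sq' (abs_lt.1 ha).1 (abs_lt.1 ha).2
  exact ⟨by linarith, by nlinarith [sq_nonneg (a / M)]⟩

/-- On the sub-extremal range the weight is `≥ 1` for `p ≥ 0` (it never helps the prover). -/
theorem one_le_kappaFactor {M a p : ℝ} (h : Kerr.IsSubextremal M a) (hp : 0 ≤ p) :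
    1 ≤ kappaFactor M a p := by
  obtain ⟨h0, h1⟩ := kappaBase_mem h
  have : (1 : ℝ) ≤ (1 - (a / M) ^ 2) ^ (-p) :=
    Real.one_le_rpow_of_pos_of_le_one_of_nonpos h0 h1 (by linarith)
  simpa [kappaFactor] using ENNReal.ofReal_le_ofReal this

/-- The weight is always finite (it is an `ofReal`). -/
theorem kappaFactor_lt_top (M a p : ℝ) : kappaFactor M a p < ⊤ := ENNReal.ofReal_lt_top

/-- The weight is monotone in `p` on the sub-extremal range (base `≤ 1`). -/
theorem kappaFactor_mono {M a : ℝ} (h : Kerr.IsSubextremal M a) {p q : ℝ} (hpq : p ≤ q) :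
    kappaFactor M a p ≤ kappaFactor M a q := by
  obtain ⟨h0, h1⟩ := kappaBase_mem h
  exact ENNReal.ofReal_le_ofReal
    (Real.rpow_le_rpow_of_exponent_ge h0 h1 (by linarith))

/-! ## §3 Non-vacuity and WLOG structure -/

/-- The zero wave is admissible (hypotheses jointly satisfiable at every `(M, a)`). -/
theorem isAdmissible_zero [Kerr.Facts] [Kerr.SliceFacts] (M a : ℝ) :
    IsAdmissible M a (fun _ ↦ 0) :=
  ⟨contMDiff_const, fun x ↦ PseudoRiemannianMetric.dalembertian_const _ 0 x,
    ⟨∅, isCompact_empty, fun _ _ _ ↦ ⟨rfl, mfderiv_const⟩⟩⟩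

/-- The zero wave has zero slice energy (so it never witnesses a violation). -/
theorem sliceEnergy_zero_wave (M a τ : ℝ) :
    sliceEnergy (Kerr.exterior M a) (fun _ ↦ (0 : ℝ)) τ = 0 := by
  have hext : Function.extend Subtype.val (fun _ : Kerr.exterior M a ↦ (0 : ℝ)) (0 : E4 → ℝ) =
      fun _ ↦ 0 := by
    funext x
    by_cases hx : ∃ y : Kerr.exterior M a, (y : E4) = x
    · obtain ⟨y, rfl⟩ := hx
      exact Subtype.val_injective.extend_apply _ _ y
    · rw [Function.extend_apply' _ _ _ hx]; rfl
  simp [sliceEnergy, coordEnergyDensity, hext]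

/-- `initEnergy` is monotone in the order `j`. -/
theorem initEnergy_mono (M a : ℝ) (ψ : Kerr.exterior M a → ℝ) {j j' : ℕ} (h : j ≤ j') :
    initEnergy M a ψ j ≤ initEnergy M a ψ j' := by
  refine lintegral_mono fun y ↦ Set.indicator_le_indicator (ENNReal.ofReal_le_ofReal ?_)
  exact Finset.sum_le_sum_of_subset_of_nonneg (Finset.range_mono (by omega))
    (fun _ _ _ ↦ sq_nonneg _)

/-- WLOG (a): the estimate is monotone in `(C, p, j)` — provers may enlarge all three. -/
theorem clauseAWith_mono [Kerr.Facts] [Kerr.SliceFacts] {M p q : ℝ} {j j' : ℕ} {C C' : ℝ≥0∞}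
    (hpq : p ≤ q) (hj : j ≤ j') (hC : C ≤ C') (h : ClauseAWith M p j C) : ClauseAWith M q j' C' := by
  intro a ha ψ hψ τ hτ
  refine (h a ha ψ hψ τ hτ).trans ?_
  gcongr
  · exact kappaFactor_mono ha hpq
  · exact initEnergy_mono M a ψ hj

/-- WLOG (b): likewise for the integrated local energy decay clause. -/
theorem clauseBWith_mono [Kerr.Facts] [Kerr.SliceFacts] {M p q : ℝ} {j j' : ℕ} {R : ℝ}
    {C C' : ℝ≥0∞} (hpq : p ≤ q) (hj : j ≤ j') (hC : C ≤ C') (h : ClauseBWith M p j R C) :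
    ClauseBWith M q j' R C' := by
  intro a ha ψ hψ
  refine (h a ha ψ hψ).trans ?_
  gcongr
  · exact kappaFactor_mono ha hpq
  · exact initEnergy_mono M a ψ hj

/-- Hence the `∃ p j` may be realised on a cofinal family: if `(p, j)` works then every
`(q, j') ≥ (p, j)` works. -/
theorem clauses_mono [Kerr.Facts] [Kerr.SliceFacts] {M p q : ℝ} {j j' : ℕ} (hpq : p ≤ q)
    (hj : j ≤ j') (h : ClauseA M p j ∧ ClauseB M p j) : ClauseA M q j' ∧ ClauseB M q j' := by
  obtain ⟨⟨C, hC, hA⟩, hB⟩ := h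
  refine ⟨⟨C, hC, clauseAWith_mono hpq hj le_rfl hA⟩, fun R ↦ ?_⟩
  obtain ⟨C', hC', hB'⟩ := hB R
  exact ⟨C', hC', clauseBWith_mono hpq hj le_rfl hB'⟩

/-! ## §4 LOAD-BEARING: the wave equation (`_false_without_waveEq`, sorry-free) -/

/-- The crux with the clause `∀ x, □_g ψ x = 0` DELETED from both (a) and (b). The instance binders
`[Kerr.Facts] [Kerr.SliceFacts]` of the crux only feed that clause (the metric), so they are dropped
too; `withoutWaveEq_implies` below certifies the relation to the crux. -/
def KappaExplicitWaveDecayWithoutWaveEq : Prop :=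
  ∀ M : ℝ, 0 < M → ∃ (p : ℝ) (j : ℕ), (∃ C : ENNReal, C < ⊤ ∧ ∀ a : ℝ, Literature.Geometry.Lorentzian.Kerr.IsSubextremal M a → ∀ ψ : Literature.Geometry.Lorentzian.Kerr.exterior M a → ℝ, (ContMDiff 𝓘(ℝ, Literature.Geometry.Lorentzian.E4) 𝓘(ℝ, ℝ) ((⊤ : ℕ∞) : WithTop ℕ∞) ψ ∧ ∃ K : Set (Literature.Geometry.Lorentzian.Kerr.exterior M a), IsCompact K ∧ ∀ x : Literature.Geometry.Lorentzian.Kerr.exterior M a, (x : Literature.Geometry.Lorentzian.E4) 0 = 0 → x ∉ K → ψ x = 0 ∧ mfderiv 𝓘(ℝ, Literature.Geometry.Lorentzian.E4) 𝓘(ℝ, ℝ) ψ x = 0) → ∀ τ : ℝ, 0 ≤ τ → Literature.Geometry.Lorentzian.sliceEnergy (Literature.Geometry.Lorentzian.Kerr.exterior M a) ψ τ ≤ C * ENNReal.ofReal ((1 - (a / M) ^ 2) ^ (-p)) * ∫⁻ y : Literature.Geometry.Lorentzian.E3, {y | Literature.Geometry.Lorentzian.E4.ofTimeSpace 0 y ∈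 Literature.Geometry.Lorentzian.Kerr.exterior M a}.indicator (fun y ↦ ENNReal.ofReal (∑ m ∈ Finset.range (j + 1), ‖iteratedFDeriv ℝ m (Function.extend Subtype.val ψ (0 : Literature.Geometry.Lorentzian.E4 → ℝ)) (Literature.Geometry.Lorentzian.E4.ofTimeSpace 0 y)‖ ^ 2)) y) ∧ ∀ R : ℝ, ∃ C : ENNReal, C < ⊤ ∧ ∀ a : ℝ, Literature.Geometry.Lorentzian.Kerr.IsSubextremal M a → ∀ ψ : Literature.Geometry.Lorentzian.Kerr.exterior M a → ℝ, (ContMDiff 𝓘(ℝ, Literature.Geometry.Lorentzian.E4) 𝓘(ℝ, ℝ) ((⊤ : ℕ∞) : WithTop ℕ∞) ψ ∧ ∃ K : Set (Literature.Geometry.Lorentzian.Kerr.exterior M a), IsCompact K ∧ ∀ x : Literature.Geometry.Lorentzian.Kerr.exterior M a, (x : Literature.Geometry.Lorentzian.E4) 0 = 0 → x ∉ K → ψ x = 0 ∧ mfderiv 𝓘(ℝ, Literature.Geometry.Lorentzian.E4) 𝓘(ℝ, ℝ) ψ x = 0) → ∫⁻ τ in Ioi (0 : ℝ), Literature.Geometry.Lorentzian.localSliceEnergy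 (Literature.Geometry.Lorentzian.Kerr.exterior M a) ψ τ R ≤ C * ENNReal.ofReal ((1 - (a / M) ^ 2) ^ (-p)) * ∫⁻ y : Literature.Geometry.Lorentzian.E3, {y | Literature.Geometry.Lorentzian.E4.ofTimeSpace 0 y ∈ Literature.Geometry.Lorentzian.Kerr.exterior M a}.indicator (fun y ↦ ENNReal.ofReal (∑ m ∈ Finset.range (j + 1), ‖iteratedFDeriv ℝ m (Function.extend Subtype.val ψ (0 : Literature.Geometry.Lorentzian.E4 → ℝ)) (Literature.Geometry.Lorentzian.E4.ofTimeSpace 0 y)‖ ^ 2)) y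

/-- Certificate: the refuted statement is the crux with one hypothesis removed — it implies the
crux (for any instances of the fact classes), hypothesis by hypothesis. -/
theorem withoutWaveEq_implies (h : KappaExplicitWaveDecayWithoutWaveEq) : KappaExplicitWaveDecay := by
  intro _ _ M hM
  obtain ⟨p, j, ⟨C, hC, hA⟩, hB⟩ := h M hM
  refine ⟨p, j, ⟨C, hC, fun a ha ψ hψ τ hτ ↦ hA a ha ψ ⟨hψ.1, hψ.2.2⟩ τ hτ⟩, fun R ↦ ?_⟩
  obtain ⟨C', hC', hB'⟩ := hB R
  exact ⟨C', hC', fun a ha ψ hψ ↦ hB' a ha ψ ⟨hψ.1, hψ.2.2⟩⟩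

namespace Witness

/-! ### The witness: `ψ(t*, y) = expNegInvGlue (t* - 1/3)` on Schwarzschild `M = 1, a = 0` -/

/-- Time profile: vanishes for `t ≤ 1/3`, positive after. -/
def prof (t : ℝ) : ℝ := expNegInvGlue (t - 1 / 3)

/-- The profile is `C^∞` (composition of `expNegInvGlue` with a translation). [folklore] -/
theorem prof_contDiff : ContDiff ℝ ∞ prof :=
  expNegInvGlue.contDiff.comp (contDiff_id.sub contDiff_const)

/-- The profile vanishes for `t ≤ 1/3`. [folklore] -/
theorem prof_eq_zero {t : ℝ} (ht : t ≤ 1 / 3) : prof t = 0 :=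
  expNegInvGlue.zero_of_nonpos (by linarith)

/-- The profile is differentiable. [folklore] -/
theorem prof_differentiable : Differentiable ℝ prof :=
  prof_contDiff.differentiable (by simp)

/-- A time `τ₀ ∈ (1/3, 4/3)` with `prof' τ₀ > 0` (mean value theorem; no closed form needed). -/
theorem exists_deriv_prof_pos : ∃ τ₀ : ℝ, 0 ≤ τ₀ ∧ 0 < deriv prof τ₀ := by
  obtain ⟨c, hc, hderiv⟩ := exists_deriv_eq_slope prof (show (1 / 3 : ℝ) < 4 / 3 by norm_num)
    prof_contDiff.continuous.continuousOn (prof_differentiable.differentiableOn)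
  refine ⟨c, by linarith [hc.1], ?_⟩
  rw [hderiv, prof_eq_zero le_rfl]
  have : 0 < prof (4 / 3) := expNegInvGlue.pos_of_pos (by norm_num)
  exact div_pos (by linarith) (by norm_num)

/-- `prof'` is continuous. [folklore] -/
theorem continuous_deriv_prof : Continuous (deriv prof) :=
  prof_contDiff.continuous_deriv (by simp)

/-- From a time of positivity of `prof'` to an interval on which `prof' ≥ prof'(τ₀)/2`. [folklore] -/
theorem exists_Ioo_deriv_prof_ge {τ₀ : ℝ} (hτ₀ : 0 ≤ τ₀) (h : 0 < deriv prof τ₀) :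
    ∃ τ₁ τ₂ : ℝ, 0 ≤ τ₁ ∧ τ₁ < τ₂ ∧ ∀ τ ∈ Ioo τ₁ τ₂, deriv prof τ₀ / 2 ≤ deriv prof τ := by
  have hev : ∀ᶠ τ in 𝓝 τ₀, deriv prof τ₀ / 2 < deriv prof τ :=
    continuous_deriv_prof.continuousAt.eventually (lt_mem_nhds (by linarith))
  obtain ⟨ε, hε, hball⟩ := Metric.eventually_nhds_iff.1 hev
  refine ⟨τ₀, τ₀ + ε / 2, hτ₀, by linarith, fun τ hτ ↦ le_of_lt (hball ?_)⟩
  rw [Real.dist_eq, abs_lt]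
  constructor <;> linarith [hτ.1, hτ.2]

/-- The time coordinate `x ↦ x 0` is `C^∞` on `E4`. [folklore] -/
theorem contDiff_coord_zero : ContDiff ℝ ∞ (fun x : E4 ↦ x 0) := by
  simpa using (EuclideanSpace.proj (𝕜 := ℝ) (0 : Fin 4)).contDiff

/-- The time coordinate has derivative the projection `proj 0`. [folklore] -/
theorem hasFDerivAt_coord_zero (x : E4) :
    HasFDerivAt (fun x : E4 ↦ x 0) (EuclideanSpace.proj (𝕜 := ℝ) (0 : Fin 4)) x := by
  simpa using (EuclideanSpace.proj (𝕜 := ℝ) (0 : Fin 4)).hasFDerivAt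

/-- The ambient witness `Ψ(x) = prof (x 0)`. -/
def Psi (x : E4) : ℝ := prof (x 0)

/-- `Ψ` is `C^∞`. [folklore] -/
theorem Psi_contDiff : ContDiff ℝ ∞ Psi :=
  prof_contDiff.comp contDiff_coord_zero

/-- `Ψ` vanishes on `{x 0 ≤ 1/3}`. [folklore] -/
theorem Psi_eq_zero {x : E4} (hx : x 0 ≤ 1 / 3) : Psi x = 0 := prof_eq_zero hx

/-- Chain rule for `Ψ = prof ∘ (x ↦ x 0)`. [folklore] -/
theorem hasFDerivAt_Psi (x : E4) :
    HasFDerivAt Psi (deriv prof (x 0) • (EuclideanSpace.proj (0 : Fin 4) : E4 →L[ℝ] ℝ)) x :=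
  (prof_differentiable (x 0)).hasDerivAt.comp_hasFDerivAt x (hasFDerivAt_coord_zero x)

/-- `∂_{t*} Ψ (x) = prof' (x 0)`. [folklore] -/
theorem fderiv_Psi_single_zero (x : E4) :
    fderiv ℝ Psi x (EuclideanSpace.single 0 1) = deriv prof (x 0) := by
  rw [(hasFDerivAt_Psi x).fderiv]
  simp

/-- The witness on the Schwarzschild exterior `M = 1`, `a = 0`. -/
def psi (x : Kerr.exterior 1 0) : ℝ := Psi x.1

/-- The witness is `C^∞` on the open submanifold `Kerr.exterior 1 0`. [folklore] -/
theorem psi_contMDiff : ContMDiff 𝓘(ℝ, E4) 𝓘(ℝ, ℝ) ∞ psi :=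
  Psi_contDiff.contMDiff.comp contMDiff_subtype_val

/-- On the exterior the zero-extension of the witness is `Ψ`. [folklore] -/
theorem extend_psi_of_mem {x : E4} (h : x ∈ Kerr.exterior 1 0) :
    Function.extend Subtype.val psi (0 : E4 → ℝ) x = Psi x :=
  Subtype.val_injective.extend_apply _ _ (⟨x, h⟩ : Kerr.exterior 1 0)

/-- Off the exterior the zero-extension of the witness is `0`. [folklore] -/
theorem extend_psi_of_not_mem {x : E4} (h : x ∉ Kerr.exterior 1 0) :
    Function.extend Subtype.val psi (0 : E4 → ℝ) x = 0 := by
  rw [Function.extend_apply']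
  · rfl
  · rintro ⟨y, rfl⟩
    exact h y.2

/-- Near the initial leaf the zero-extension vanishes identically. -/
theorem extend_psi_eq_zero {x : E4} (hx : x 0 ≤ 1 / 3) :
    Function.extend Subtype.val psi (0 : E4 → ℝ) x = 0 := by
  by_cases h : x ∈ Kerr.exterior 1 0
  · rw [extend_psi_of_mem h]
    exact Psi_eq_zero hx
  · exact extend_psi_of_not_mem h

/-- On the open set `{x 0 < 1/3}` the zero-extension is locally the zero function. [folklore] -/
theorem extend_psi_eventuallyEq_zero {x : E4} (hx : x 0 < 1 / 3) :
    Function.extend Subtype.val psi (0 : E4 → ℝ) =ᶠ[𝓝 x] fun _ ↦ 0 := by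
  have hopen : IsOpen {y : E4 | y 0 < 1 / 3} :=
    isOpen_lt (EuclideanSpace.proj (0 : Fin 4)).continuous continuous_const
  filter_upwards [hopen.mem_nhds hx] with y hy
  exact extend_psi_eq_zero (le_of_lt hy)

/-- All derivatives of the zero-extended witness vanish on the initial leaf: `E_j[ψ](0) = 0`. -/
theorem iteratedFDeriv_extend_psi_slice (m : ℕ) (y : E3) :
    iteratedFDeriv ℝ m (Function.extend Subtype.val psi (0 : E4 → ℝ)) (E4.ofTimeSpace 0 y) = 0 := by
  have h := (extend_psi_eventuallyEq_zero (x := E4.ofTimeSpace 0 y) (by simp)).iteratedFDeriv ℝ m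
  rw [h.self_of_nhds]
  simp

/-- On the (open) exterior the zero-extension agrees with `Ψ` near every point. -/
theorem extend_psi_eventuallyEq {x : E4} (hx : x ∈ Kerr.exterior 1 0) :
    Function.extend Subtype.val psi (0 : E4 → ℝ) =ᶠ[𝓝 x] Psi := by
  filter_upwards [(Kerr.exterior 1 0).isOpen.mem_nhds hx] with y hy
  exact extend_psi_of_mem hy

/-- The Schwarzschild exterior `M = 1`, `a = 0` is `{‖y‖ > 2}`. -/
theorem mem_exterior_one_zero {x : E4} : x ∈ Kerr.exterior 1 0 ↔ 2 < E4.spatialNorm x := by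
  rw [Kerr.mem_exterior, Kerr.radius_zero_left, Kerr.rPlus_zero_right zero_le_one, max_lt_iff]
  constructor
  · rintro ⟨h, -⟩; linarith
  · intro h; exact ⟨by linarith, by linarith⟩

/-- The leaf `{t* = τ}` of the Schwarzschild exterior `M = 1, a = 0` is `{‖y‖ > 2}`. [folklore] -/
theorem sliceSet_eq (τ : ℝ) :
    {y : E3 | E4.ofTimeSpace τ y ∈ Kerr.exterior 1 0} = {y | 2 < ‖y‖} := by
  ext y
  simp only [Set.mem_setOf_eq, mem_exterior_one_zero, E4.spatialNorm_ofTimeSpace]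

/-- Energy density of the witness at `(τ, y)` in the exterior is at least `prof'(τ)²`. -/
theorem coordEnergyDensity_ge {τ : ℝ} {y : E3} (hy : E4.ofTimeSpace τ y ∈ Kerr.exterior 1 0) :
    deriv prof τ ^ 2 ≤ coordEnergyDensity (Kerr.exterior 1 0) psi (E4.ofTimeSpace τ y) := by
  unfold coordEnergyDensity
  have h0 : (fderiv ℝ (Function.extend Subtype.val psi (0 : E4 → ℝ)) (E4.ofTimeSpace τ y)
      (EuclideanSpace.single 0 (1 : ℝ))) ^ 2 = deriv prof τ ^ 2 := by
    rw [(extend_psi_eventuallyEq hy).fderiv_eq, fderiv_Psi_single_zero]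
    simp
  rw [← h0]
  exact Finset.single_le_sum (f := fun μ : Fin 4 ↦ (fderiv ℝ (Function.extend Subtype.val psi
    (0 : E4 → ℝ)) (E4.ofTimeSpace τ y) (EuclideanSpace.single μ (1 : ℝ))) ^ 2)
    (fun i _ ↦ sq_nonneg _) (Finset.mem_univ 0)

/-- The witness has positive (indeed infinite) slice energy whenever `prof'(τ) > 0`. -/
theorem sliceEnergy_pos {τ : ℝ} (hτ : 0 < deriv prof τ) :
    0 < sliceEnergy (Kerr.exterior 1 0) psi τ := by
  unfold sliceEnergy
  have hS : MeasurableSet {y : E3 | E4.ofTimeSpace τ y ∈ Kerr.exterior 1 0} :=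
    ((Kerr.exterior 1 0).isOpen.preimage (E4.continuous_ofTimeSpace τ)).measurableSet
  have hle : {y : E3 | E4.ofTimeSpace τ y ∈ Kerr.exterior 1 0}.indicator
      (fun _ ↦ ENNReal.ofReal (deriv prof τ ^ 2)) ≤
      {y : E3 | E4.ofTimeSpace τ y ∈ Kerr.exterior 1 0}.indicator
      (fun y ↦ ENNReal.ofReal (coordEnergyDensity (Kerr.exterior 1 0) psi (E4.ofTimeSpace τ y))) := by
    intro y
    by_cases hy : E4.ofTimeSpace τ y ∈ Kerr.exterior 1 0
    · have hy' : y ∈ {y : E3 | E4.ofTimeSpace τ y ∈ Kerr.exterior 1 0} := hy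
      rw [Set.indicator_of_mem hy', Set.indicator_of_mem hy']
      exact ENNReal.ofReal_le_ofReal (coordEnergyDensity_ge hy)
    · have hy' : y ∉ {y : E3 | E4.ofTimeSpace τ y ∈ Kerr.exterior 1 0} := hy
      rw [Set.indicator_of_notMem hy', Set.indicator_of_notMem hy']
  refine lt_of_lt_of_le ?_ (lintegral_mono hle)
  rw [lintegral_indicator_const hS]
  refine ENNReal.mul_pos (ENNReal.ofReal_pos.2 (by positivity)).ne' ?_
  have hopen : IsOpen {y : E3 | E4.ofTimeSpace τ y ∈ Kerr.exterior 1 0} :=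
    (Kerr.exterior 1 0).isOpen.preimage (E4.continuous_ofTimeSpace τ)
  refine (hopen.measure_pos volume ⟨EuclideanSpace.single 0 3, ?_⟩).ne'
  rw [sliceSet_eq, Set.mem_setOf_eq, EuclideanSpace.single, PiLp.norm_single, Real.norm_eq_abs]
  norm_num

/-- Positivity of a set-`lintegral` over `(0, ∞)` from a uniform lower bound on a subinterval.
[folklore] -/
theorem setLIntegral_Ioi_pos {F : ℝ → ℝ≥0∞} {τ₁ τ₂ : ℝ} (h₁ : 0 ≤ τ₁) (h12 : τ₁ < τ₂) {c : ℝ≥0∞}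
    (hc : c ≠ 0) (hF : ∀ τ ∈ Ioo τ₁ τ₂, c ≤ F τ) : 0 < ∫⁻ τ in Ioi (0 : ℝ), F τ := by
  have hsub : Ioo τ₁ τ₂ ⊆ Ioi (0 : ℝ) := fun τ hτ ↦ lt_of_le_of_lt h₁ hτ.1
  have hle : (Ioo τ₁ τ₂).indicator (fun _ ↦ c) ≤ fun τ ↦ F τ := by
    intro τ
    by_cases hτ : τ ∈ Ioo τ₁ τ₂
    · rw [Set.indicator_of_mem hτ]; exact hF τ hτ
    · rw [Set.indicator_of_notMem hτ]; exact zero_le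
  calc (0 : ℝ≥0∞) < c * volume (Ioo τ₁ τ₂) := by
        refine ENNReal.mul_pos hc ?_
        rw [Real.volume_Ioo]; exact (ENNReal.ofReal_pos.2 (by linarith)).ne'
    _ = ∫⁻ τ in Ioi (0 : ℝ), (Ioo τ₁ τ₂).indicator (fun _ ↦ c) τ := by
        rw [lintegral_indicator_const measurableSet_Ioo, Measure.restrict_apply measurableSet_Ioo,
          Set.inter_eq_self_of_subset_left hsub]
    _ ≤ ∫⁻ τ in Ioi (0 : ℝ), F τ := lintegral_mono hle

/-- The shell `{2 < ‖y‖} ∩ closedBall 0 3` has positive volume. [folklore] -/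
theorem volume_shell_pos :
    0 < volume ({y : E3 | 2 < ‖y‖} ∩ Metric.closedBall (0 : E3) 3) := by
  have hopen : IsOpen ({y : E3 | 2 < ‖y‖} ∩ Metric.ball (0 : E3) 3) :=
    (isOpen_lt continuous_const continuous_norm).inter Metric.isOpen_ball
  have hne : ({y : E3 | 2 < ‖y‖} ∩ Metric.ball (0 : E3) 3).Nonempty := by
    refine ⟨EuclideanSpace.single 0 (5 / 2), ?_, ?_⟩
    · rw [Set.mem_setOf_eq, EuclideanSpace.single, PiLp.norm_single, Real.norm_eq_abs]; norm_num
    · rw [Metric.mem_ball, dist_zero_right, EuclideanSpace.single, PiLp.norm_single,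
        Real.norm_eq_abs]; norm_num
  exact (hopen.measure_pos volume hne).trans_le
    (measure_mono (Set.inter_subset_inter_right _ Metric.ball_subset_closedBall))

/-- Local energy of the witness in the ball of radius `3`: at least `prof'(τ)²` times the volume of
the shell `{2 < ‖y‖ ≤ 3}`. [folklore] -/
theorem localSliceEnergy_ge (τ : ℝ) :
    ENNReal.ofReal (deriv prof τ ^ 2) * volume ({y : E3 | 2 < ‖y‖} ∩ Metric.closedBall (0 : E3) 3) ≤
      localSliceEnergy (Kerr.exterior 1 0) psi τ 3 := by
  unfold localSliceEnergy
  have hS : MeasurableSet {y : E3 | E4.ofTimeSpace τ y ∈ Kerr.exterior 1 0} :=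
    ((Kerr.exterior 1 0).isOpen.preimage (E4.continuous_ofTimeSpace τ)).measurableSet
  have hle : {y : E3 | E4.ofTimeSpace τ y ∈ Kerr.exterior 1 0}.indicator
      (fun _ ↦ ENNReal.ofReal (deriv prof τ ^ 2)) ≤
      {y : E3 | E4.ofTimeSpace τ y ∈ Kerr.exterior 1 0}.indicator
      (fun y ↦ ENNReal.ofReal (coordEnergyDensity (Kerr.exterior 1 0) psi (E4.ofTimeSpace τ y))) := by
    intro y
    by_cases hy : E4.ofTimeSpace τ y ∈ Kerr.exterior 1 0
    · have hy' : y ∈ {y : E3 | E4.ofTimeSpace τ y ∈ Kerr.exterior 1 0} := hy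
      rw [Set.indicator_of_mem hy', Set.indicator_of_mem hy']
      exact ENNReal.ofReal_le_ofReal (coordEnergyDensity_ge hy)
    · have hy' : y ∉ {y : E3 | E4.ofTimeSpace τ y ∈ Kerr.exterior 1 0} := hy
      rw [Set.indicator_of_notMem hy', Set.indicator_of_notMem hy']
  refine le_trans (le_of_eq ?_) (lintegral_mono hle)
  rw [lintegral_indicator_const hS, Measure.restrict_apply hS, sliceSet_eq]

/-- The integrated local energy `∫₀^∞ E_loc(τ, 3) dτ` of the witness is positive. [folklore] -/
theorem integratedLocalEnergy_pos {τ₀ : ℝ} (hτ₀ : 0 ≤ τ₀) (h : 0 < deriv prof τ₀) :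
    0 < ∫⁻ τ in Ioi (0 : ℝ), localSliceEnergy (Kerr.exterior 1 0) psi τ 3 := by
  obtain ⟨τ₁, τ₂, h₁, h12, hge⟩ := exists_Ioo_deriv_prof_ge hτ₀ h
  refine setLIntegral_Ioi_pos h₁ h12 (c := ENNReal.ofReal ((deriv prof τ₀ / 2) ^ 2) *
    volume ({y : E3 | 2 < ‖y‖} ∩ Metric.closedBall (0 : E3) 3)) ?_ fun τ hτ ↦ ?_
  · exact (ENNReal.mul_pos (ENNReal.ofReal_pos.2 (by positivity)).ne' volume_shell_pos.ne').ne'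
  · refine le_trans ?_ (localSliceEnergy_ge τ)
    have h2 : 0 ≤ deriv prof τ₀ / 2 := by linarith
    exact mul_le_mul_of_nonneg_right (ENNReal.ofReal_le_ofReal (pow_le_pow_left₀ h2 (hge τ hτ) 2))
      zero_le

/-- Near a point of the exterior with `t* < 1/3` the witness is locally zero. [folklore] -/
theorem psi_eventuallyEq_zero {x : Kerr.exterior 1 0} (hx : (x : E4) 0 < 1 / 3) :
    psi =ᶠ[𝓝 x] fun _ ↦ 0 := by
  have hcont : Continuous fun x' : Kerr.exterior 1 0 ↦ (x' : E4) 0 :=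
    contDiff_coord_zero.continuous.comp continuous_subtype_val
  have hopen : IsOpen {x' : Kerr.exterior 1 0 | (x' : E4) 0 < 1 / 3} :=
    isOpen_lt hcont continuous_const
  filter_upwards [hopen.mem_nhds hx] with x' hx'
  exact Psi_eq_zero (le_of_lt hx')

/-- The differential of the witness vanishes on the initial leaf `{t* = 0}`. [folklore] -/
theorem mfderiv_psi_eq_zero {x : Kerr.exterior 1 0} (hx : (x : E4) 0 = 0) :
    mfderiv 𝓘(ℝ, E4) 𝓘(ℝ, ℝ) psi x = 0 := by
  rw [(psi_eventuallyEq_zero (x := x) (by rw [hx]; norm_num)).mfderiv_eq]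
  exact mfderiv_const

/-- The witness satisfies every admissibility clause except the wave equation (with `K = ∅`). -/
theorem psi_smooth_and_compactData :
    ContMDiff 𝓘(ℝ, E4) 𝓘(ℝ, ℝ) ((⊤ : ℕ∞) : WithTop ℕ∞) psi ∧ HasCompactData 1 0 psi :=
  ⟨psi_contMDiff, ∅, isCompact_empty, fun x hx _ ↦
    ⟨Psi_eq_zero (by rw [hx]; norm_num), mfderiv_psi_eq_zero hx⟩⟩

/-- `E_j[ψ](0) = 0` for every `j`. -/
theorem initEnergy_psi_eq_zero (j : ℕ) : initEnergy 1 0 psi j = 0 := by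
  simp [initEnergy, iteratedFDeriv_extend_psi_slice]

end Witness

open Witness in
/-- **LOAD-BEARING HYPOTHESIS `□_g ψ = 0`.** The crux with the wave-equation clause deleted is
false: clause (a) already fails on Schwarzschild `(M, a) = (1, 0)` for EVERY `(p, j, C)`, witnessed
by `ψ(t*, y) = expNegInvGlue (t* - 1/3)` — RHS `= C · 1 · E_j[ψ](0) = 0`, LHS `> 0` at a time
`τ₀ ∈ (1/3, 4/3)`. Any proof of the crux must use `□_g ψ = 0` to transport information off the
initial leaf. [folklore] -/
theorem kappaExplicitWaveDecay_false_without_waveEq : ¬ KappaExplicitWaveDecayWithoutWaveEq := by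
  intro h
  obtain ⟨p, j, ⟨C, -, hA⟩, -⟩ := h 1 one_pos
  obtain ⟨τ₀, hτ₀, hder⟩ := exists_deriv_prof_pos
  have key := hA 0 (by norm_num [Kerr.IsSubextremal]) psi psi_smooth_and_compactData τ₀ hτ₀
  have h0 : (∫⁻ y : E3, {y | E4.ofTimeSpace 0 y ∈ Kerr.exterior 1 0}.indicator (fun y ↦
      ENNReal.ofReal (∑ m ∈ Finset.range (j + 1), ‖iteratedFDeriv ℝ m (Function.extend Subtype.val
        psi (0 : E4 → ℝ)) (E4.ofTimeSpace 0 y)‖ ^ 2)) y) = 0 := initEnergy_psi_eq_zero j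
  rw [h0, mul_zero] at key
  exact (sliceEnergy_pos hder).ne' (le_zero_iff.mp key)

open Witness in
/-- **The wave equation is load-bearing in conjunct (b) too.** With `□_g ψ = 0` deleted, the
integrated local energy decay clause fails on Schwarzschild `(M, a) = (1, 0)` for every `(p, j)`, at
radius `R = 3` and every constant `C`: the same witness has RHS `= 0` and
`∫₀^∞ E_loc(τ, 3) dτ > 0` (continuity of `prof'` around `τ₀`). Stated with the bundled names; it
is the second conjunct of `KappaExplicitWaveDecayWithoutWaveEq` unfolded. [folklore] -/
theorem clauseB_false_without_waveEq : ¬ (∀ M : ℝ, 0 < M → ∃ (p : ℝ) (j : ℕ), ∀ R : ℝ,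
    ∃ C : ℝ≥0∞, C < ⊤ ∧ ∀ a : ℝ, Kerr.IsSubextremal M a → ∀ ψ : Kerr.exterior M a → ℝ,
      (ContMDiff 𝓘(ℝ, E4) 𝓘(ℝ, ℝ) ∞ ψ ∧ HasCompactData M a ψ) →
        ∫⁻ τ in Ioi (0 : ℝ), localSliceEnergy (Kerr.exterior M a) ψ τ R ≤
          C * kappaFactor M a p * initEnergy M a ψ j) := by
  intro h
  obtain ⟨p, j, hB⟩ := h 1 one_pos
  obtain ⟨C, -, hC⟩ := hB 3
  obtain ⟨τ₀, hτ₀, hder⟩ := exists_deriv_prof_pos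
  have key := hC 0 (by norm_num [Kerr.IsSubextremal]) psi psi_smooth_and_compactData
  rw [initEnergy_psi_eq_zero, mul_zero] at key
  exact (integratedLocalEnergy_pos hτ₀ hder).ne' (le_zero_iff.mp key)

/-- Sanity: the two sorry-free refutations above are exactly the two conjuncts of
`KappaExplicitWaveDecayWithoutWaveEq` (the second via the bundled names). [folklore] -/
theorem withoutWaveEq_conjB_of (h : KappaExplicitWaveDecayWithoutWaveEq) :
    ∀ M : ℝ, 0 < M → ∃ (p : ℝ) (j : ℕ), ∀ R : ℝ,
    ∃ C : ℝ≥0∞, C < ⊤ ∧ ∀ a : ℝ, Kerr.IsSubextremal M a → ∀ ψ : Kerr.exterior M a → ℝ,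
      (ContMDiff 𝓘(ℝ, E4) 𝓘(ℝ, ℝ) ∞ ψ ∧ HasCompactData M a ψ) →
        ∫⁻ τ in Ioi (0 : ℝ), localSliceEnergy (Kerr.exterior M a) ψ τ R ≤
          C * kappaFactor M a p * initEnergy M a ψ j := by
  intro M hM
  obtain ⟨p, j, -, hB⟩ := h M hM
  exact ⟨p, j, fun R ↦ hB R⟩

/-! ## §5 LOAD-BEARING on paper, blocked in the tree: the `IsSubextremal` guard -/

/-- The crux with the guard `Kerr.IsSubextremal M a` DELETED (all real `a`, including `|a| = M`
where `kappaFactor = 0` for `p ≠ 0`, and `|a| > M` where `r₊ = M` is junk and `{r > M}` has a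
timelike inner boundary). -/
def KappaExplicitWaveDecayWithoutSubextremal : Prop :=
  ∀ [Kerr.Facts] [Kerr.SliceFacts], ∀ M : ℝ, 0 < M → ∃ (p : ℝ) (j : ℕ),
    (∃ C : ℝ≥0∞, C < ⊤ ∧ ∀ a : ℝ, ∀ ψ : Kerr.exterior M a → ℝ, IsAdmissible M a ψ →
      ∀ τ : ℝ, 0 ≤ τ → sliceEnergy (Kerr.exterior M a) ψ τ ≤
        C * kappaFactor M a p * initEnergy M a ψ j) ∧
    ∀ R : ℝ, ∃ C : ℝ≥0∞, C < ⊤ ∧ ∀ a : ℝ, ∀ ψ : Kerr.exterior M a → ℝ, IsAdmissible M a ψ →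
      ∫⁻ τ in Ioi (0 : ℝ), localSliceEnergy (Kerr.exterior M a) ψ τ R ≤
        C * kappaFactor M a p * initEnergy M a ψ j

/-- The hypothesis nobody can currently discharge in the tree: ONE nonzero admissible wave on
extremal Kerr `a = M` with finite order-`j` data for all `j`, positive energy at some `τ ≥ 0`, and —
to also kill `p = 0` — unbounded energy ratio is NOT needed: we ask for a family indexed by the
putative constant. Paper status: exists (Cauchy problem for `□_g` on the extremal exterior with
smooth compactly supported data; any nonzero datum). -/
def ExtremalWaveExists (M : ℝ) : Prop :=
  ∀ [Kerr.Facts] [Kerr.SliceFacts], ∃ ψ : Kerr.exterior M M → ℝ, IsAdmissible M M ψ ∧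
    (∀ j, initEnergy M M ψ j < ⊤) ∧ ∃ τ : ℝ, 0 ≤ τ ∧ 0 < sliceEnergy (Kerr.exterior M M) ψ τ

/-- NEGATIVE LEMMA MODULO `ExtremalWaveExists` (shape `H → ¬ CruxWithoutGuard`), for the `p ≠ 0`
branch: at `a = M` the weight is the junk `0`, the RHS vanishes, and any wave with positive energy
violates (a). The `p = 0` branch needs a genuinely unbounded family (extremal non-decay /
superextremal incoming waves) and is left open here. Any proof of the crux must use the guard
`|a| < M` (if only to keep `kappaFactor ≠ 0`). -/
theorem clauseA_false_at_extremal_of_wave [Kerr.Facts] [Kerr.SliceFacts] {M p : ℝ} (hM : 0 < M)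
    (hp : p ≠ 0) (j : ℕ) (C : ℝ≥0∞)
    (hW : ∃ ψ : Kerr.exterior M M → ℝ, IsAdmissible M M ψ ∧
      ∃ τ : ℝ, 0 ≤ τ ∧ 0 < sliceEnergy (Kerr.exterior M M) ψ τ) :
    ¬ (∀ ψ : Kerr.exterior M M → ℝ, IsAdmissible M M ψ → ∀ τ : ℝ, 0 ≤ τ →
      sliceEnergy (Kerr.exterior M M) ψ τ ≤ C * kappaFactor M M p * initEnergy M M ψ j) := by
  intro h
  obtain ⟨ψ, hψ, τ, hτ, hpos⟩ := hW
  have key := h ψ hψ τ hτ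
  rw [(kappaFactor_extremal hM.ne' hp).1, mul_zero, zero_mul] at key
  exact hpos.ne' (le_zero_iff.mp key)

/-! ## §6 Shape of a refutation, and the weakest sector -/

/-- **What a kill must produce.** `¬ KappaExplicitWaveDecay` is EQUIVALENT to: instances of the two
fact classes (nobody has constructed them: analyticity/connectedness of the Kerr–Schild chart and
slice) AND a mass `M` at which, for every `(p, j)`, one of the two clauses fails — i.e. for every
`(p, j, C)` an explicit sub-extremal spin, an explicit admissible wave and a time (or radius) beating
`C (1-(a/M)²)^(-p) E_j`. No admissible wave other than `0` is constructible in the tree today. -/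
theorem not_kappaExplicitWaveDecay_iff : ¬ KappaExplicitWaveDecay ↔
    ∃ (_ : Kerr.Facts) (_ : Kerr.SliceFacts), ∃ M : ℝ, 0 < M ∧
      ∀ (p : ℝ) (j : ℕ), ¬ (ClauseA M p j ∧ ClauseB M p j) := by
  rw [kappaExplicitWaveDecay_iff]
  constructor
  · intro h
    by_contra hne
    apply h
    intro iF iS M hM
    by_contra hall
    exact hne ⟨iF, iS, M, hM, fun p j hpj ↦ hall ⟨p, j, hpj⟩⟩
  · rintro ⟨iF, iS, M, hM, hno⟩ h
    obtain ⟨p, j, hpj⟩ := @h iF iS M hM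
    exact hno p j hpj

/-- The crux implies its axisymmetric support item (`AxisymmetricKappaWaveDecay`, rank 9): the extra
hypothesis `Φψ = 0` is simply dropped. Contrapositive for refuters: killing the m = 0 sector kills
the crux — but that is the MOST robust sector (Aretakis 2012: bounded non-degenerate energy at
`κ = 0` for axisymmetric waves; data supported off `𝓗⁺` push the instability to third-order
derivatives, Gajic 2023 Thm A(ii)); the soft sector is `|m| ≥ 2`, `m → ∞` (Gajic 2023 §1.4). -/
theorem axisymmetric_of_kappa (h : KappaExplicitWaveDecay) : AxisymmetricKappaWaveDecay := by
  intro iF iS M hM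
  obtain ⟨p, j, ⟨C, hC, hA⟩, hB⟩ := @h iF iS M hM
  refine ⟨p, j, ⟨C, hC, fun a ha ψ hψ _ τ hτ ↦ hA a ha ψ hψ τ hτ⟩, fun R ↦ ?_⟩
  obtain ⟨C', hC', hB'⟩ := hB R
  exact ⟨C', hC', fun a ha ψ hψ _ ↦ hB' a ha ψ hψ⟩

/-- Hence a refutation of the support item is a refutation of the crux. -/
theorem not_kappa_of_not_axisymmetric (h : ¬ AxisymmetricKappaWaveDecay) : ¬ KappaExplicitWaveDecay :=
  fun hk ↦ h (axisymmetric_of_kappa hk)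

/-! ## §7 Near-zone phase portrait at the superradiant threshold (small-model algebra)

In the blown-up variable `x = (r - r₊)/(r₊ - r₋)` the EXACT radial equation is
`(x(x+1)R')' + [(σ + ω x (2r₊ + (r₊-r₋)x))² / (x(x+1)) - Λ] R = 0`, `σ = (ω - mΩ_H)/(2κ)`; at
`κ = 0`, `ω = m/2M` the bracket is `N(x)/(x(x+1))` with the quadratic `N` below. Its sign pattern
decides wells/barriers: discriminant `Λ(Λ - 4σm + 4σ²)`. Consequences recorded for the lines:
every superradiant `σ < 0` (with `Λ > 0`, `m² > Λ`) sees a barrier with a horizon-side well whose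
horizon end is OPEN (waves `x^{-iσ}` fall in freely) — no quasi-bound states, no `exp(c/κ)`; the
barrier top (double root, `σ = σ₋ = (m - √(m²-Λ))/2`) is the in-throat trapped photon orbit with
Lyapunov exponent `≍ κ` in `t` — resolvent loss `≍ κ⁻¹ log m`, polynomial. -/

/-- The near-zone numerator `N(x) = (m² - Λ)x² + (2σm - Λ)x + σ²`. -/
def nearZoneNumerator (σ m Λ x : ℝ) : ℝ := (m ^ 2 - Λ) * x ^ 2 + (2 * σ * m - Λ) * x + σ ^ 2

/-- `(σ + m x)² - Λ x (x + 1) = N(x)`. [folklore] -/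
theorem nearZoneNumerator_eq (σ m Λ x : ℝ) :
    (σ + m * x) ^ 2 - Λ * x * (x + 1) = nearZoneNumerator σ m Λ x := by
  unfold nearZoneNumerator; ring

/-- Discriminant of `N`: `(2σm - Λ)² - 4σ²(m² - Λ) = Λ(Λ - 4σm + 4σ²)`. [folklore] -/
theorem nearZone_discriminant (σ m Λ : ℝ) :
    (2 * σ * m - Λ) ^ 2 - 4 * σ ^ 2 * (m ^ 2 - Λ) = Λ * (Λ - 4 * σ * m + 4 * σ ^ 2) := by
  ring

/-- On the superradiant side `σ ≤ 0` (with `Λ > 0`, `0 ≤ m`) the discriminant is positive: two real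
turning points, i.e. a genuine barrier — superradiant near-threshold frequencies are never
barrier-free in the throat. [folklore] -/
theorem nearZone_discriminant_pos_of_superradiant {σ m Λ : ℝ} (hσ : σ ≤ 0) (hm : 0 ≤ m)
    (hΛ : 0 < Λ) : 0 < (2 * σ * m - Λ) ^ 2 - 4 * σ ^ 2 * (m ^ 2 - Λ) := by
  rw [nearZone_discriminant]
  have h2 : 0 < Λ - 4 * σ * m + 4 * σ ^ 2 := by
    nlinarith [mul_nonneg (neg_nonneg.2 hσ) hm, sq_nonneg σ]
  exact mul_pos hΛ h2

/-- At the threshold itself (`σ = 0`) the well degenerates: `N(x) = x((m² - Λ)x - Λ)`, a barrier on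
`(0, Λ/(m² - Λ))` touching the horizon. [folklore] -/
theorem nearZoneNumerator_threshold (m Λ x : ℝ) :
    nearZoneNumerator 0 m Λ x = x * ((m ^ 2 - Λ) * x - Λ) := by
  unfold nearZoneNumerator; ring

/-- In the window `Λ - 4σm + 4σ² < 0` (i.e. `σ` strictly between the two barrier tops
`(m ∓ √(m² - Λ))/2`) there is NO turning point: `N > 0` everywhere when `0 < Λ < m²` — the
barrier-free strip through which the throat talks to infinity (for `Λ ≤ 0` the strip does not
exist: the discriminant is then `≥ 0`). [folklore] -/
theorem nearZoneNumerator_pos_of_window {σ m Λ x : ℝ} (hΛ : 0 < Λ) (hmΛ : Λ < m ^ 2)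
    (hwin : Λ - 4 * σ * m + 4 * σ ^ 2 < 0) : 0 < nearZoneNumerator σ m Λ x := by
  have hdisc : (2 * σ * m - Λ) ^ 2 - 4 * σ ^ 2 * (m ^ 2 - Λ) < 0 := by
    rw [nearZone_discriminant]; exact mul_neg_of_pos_of_neg hΛ hwin
  unfold nearZoneNumerator
  have ha : 0 < m ^ 2 - Λ := by linarith
  nlinarith [sq_nonneg (2 * (m ^ 2 - Λ) * x + (2 * σ * m - Λ)), ha, hdisc]

end Summit.FinalStateConjecture.FinalStateConjecture.Cruxes.KappaExplicitWaveDecay.Disproof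

end
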